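import Literature.Barriers.CriticalPhenomena.PlaquetteWalkHoleRootHoleColumnPhases
import Literature.Barriers.CriticalPhenomena.PlaquetteWalkAngleLimitColumnCoherence
import HarnessLib

/-!
# Barrier catalogue (SAWScalingLimit): in the HOLE COLUMN the straight level-`7` member has LIMIT WEIGHT `(√2)⁷ · ζ^{4k}`, `k ∈ {7, 2, 4}` — three of the
four census phases, no antipodal pair («HOLE COLUMN: THE LIMIT WEIGHT»)

`Z → ∞` limit model of the printed Yang–Baxter weights [GlazmanManolescu2019, §1, eq. (1)]; the «RECTANGLE COEFFICIENT» line (b-engine-1 g29), the step after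
the CLASSES step (`PlaquetteWalkHoleRootHoleColumnPhases`) of the HOLE-COLUMN programme (lane file FINDING-YB-HOLE-COLUMN-FOUR-PHASE, §2 and §5). For a wound
class-`B2a` walk `ω` of limit cost `7` from the hole root `w.side W` (hole `(w.1 − 1, w.2)` absent) with a slanted end, a STRAIGHT first arc at a hole-column
rhombus `r` (`r.1 = w.1 − 1`) strictly above the hole and some arc above the row of `r`, the phase index is `X = (9 + 3a + 5b) mod 8` with `a, b ∈ {0, 1}` the
indicators of the two possible kisses (`ΩG.phaseIndex_of_cost_seven_straight_holeColumn_above`). Here the PHASE LAW (`limitWeight_eq_phaseIndex`) is cashed: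

* `ΩG.isolated_eq_seven_of_cost_seven_straight_holeColumn_above` — the end is `N` and `n_{u₁} + n_{u₂} = 7` (the magnitude is `(√2)⁷`);
* ★★★ `ΩG.limitWeight_of_cost_seven_straight_holeColumn_above` — **`limitWeight = (√2)⁷ · ζ^{4k}`, `k = (7 + 3a + 5b) mod 8`** (`ζ = e^{iπ/16}`; `k = X + 6`
  because `(ζ⁴ + ζ¹²)⁷ = (√2)⁷ ζ⁵⁶ = (√2)⁷ ζ²⁴` and the slot sign of `N` is `+1`): no kiss `↦ ζ²⁸` (`k = 7`), kiss at `p₁` only `↦ ζ⁸` (`k = 2`), hook kiss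
  only `↦ ζ¹⁶` (`k = 4`), both kisses `↦ ζ²⁸` (`k = 7`);
* ★★★ `ΩG.limitWeight_mem_of_cost_seven_straight_holeColumn_above` / `ΩG.phaseIndex_mem_of_cost_seven_straight_holeColumn_above` — hence
  `limitWeight ∈ {(√2)⁷ζ²⁸, (√2)⁷ζ⁸, (√2)⁷ζ¹⁶}` and `phaseIndex ∈ {1, 4, 6}`: the phases `k ∈ {7, 2, 4}` of these members contain NO ANTIPODAL PAIR
  `{k, k + 4}`, so by `PlaquetteWalkAngleLimitAntipode.sum_phases_above_eq_zero_iff` (phases `1, 2, 4, 7`) they can never cancel among themselves — the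
  lane census (kit j298353: 1 127 hole-column cells above the hole; these members occur with `k = 7, 2, 4, 7` at 604, 612, 610, 619 cells) is
  exactly this statement, the fourth census phase `k = 1` being carried by the class-`B2b` members only.

[GlazmanManolescu2019 §1 eq. (1), Lemma 2.1, Remark 2.2; Glazman2015WeightedSAW Lemma 3.1 (proof); the `Z → ∞` bookkeeping is lane plumbing on the
printed weights.]
-/

noncomputable section

namespace Literature.Probability.RandomPlanarGeometry.SAW.YangBaxter

open Real
open Literature.Barriers.CriticalPhenomena.PlaquetteWalk

namespace ΩG

variable {D : Set Face} {w r : Face} {ω : ΩG D (w.side .W) r}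

/-- `ζ^n = ζ^{n mod 32}` (`ζ³² = 1`). [cite: GlazmanManolescu2019, §1, eq. (1) (lane plumbing)] -/
private theorem zeta32_pow_mod (n : ℕ) : zeta32 ^ n = zeta32 ^ (n % 32) := by
  conv_lhs => rw [← Nat.mod_add_div n 32, pow_add, pow_mul, zeta32_pow_thirtyTwo, one_pow, mul_one]

/-- ★ **HOLE COLUMN: the level-`7` member ends at `N` with seven isolated turns.** Under the hypotheses of the hole-column programme (wound class-`B2a`,
limit cost `7`, slanted end, straight first arc at `r = (w.1 − 1, r.2)` above the hole, an arc above the row of `r`): `ω.1 = N` and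
`n_{u₁} + n_{u₂} = 7` — so the magnitude of the limit weight is `(√2)⁷`. [cite: GlazmanManolescu2019, §1, Fig. 1 and eq. (1); Lemma 2.1, eq. (CR)]
[cite: Glazman2015WeightedSAW, Lemma 3.1 (proof, pp. 6–7)] -/
theorem isolated_eq_seven_of_cost_seven_straight_holeColumn_above (hh : holeFaceW w ∉ D) (hr : RootedFace D (w.side .W) r) (h : ω.IsB2a)
    (hA : ω.AJ hr h (toC (midPt (w.side .W))) ≠ 0) (hc : cost (slotOfSide ω.1) ω.2.mids = 7) (hz : ω.1 = .N ∨ ω.1 = .S)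
    (hstr8 : arcKind (ω.2.sIn ω.2.firstHitG) (ω.2.sOut ω.2.firstHitG) = .straight) (hcol : r.1 = w.1 - 1) (habove : w.2 < r.2)
    (hup : ∃ j < ω.2.arcs.length, r.2 < (ω.2.fc j).2) :
    ω.1 = .N ∧ cfgCount ω.2.mids [.corner] + cfgCount ω.2.mids [.coCorner] = 7 := by
  have hN : ω.1 = .N := (descent_of_cost_seven_straight_holeColumn_above hh hr h hA hc hz hstr8 hcol habove hup).1
  refine ⟨hN, ?_⟩
  have hdeg : slotDeg (slotOfSide ω.1) = 1 := by rw [hN]; rfl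
  have hc' := hc
  unfold cost at hc'
  rw [hdeg] at hc'
  omega

/-- ★★★ **HOLE COLUMN: THE LIMIT WEIGHT OF THE LEVEL-`7` MEMBER.** For a wound class-`B2a` walk of limit cost `7` from the hole root `w.side W` (hole absent)
with a slanted end and a straight first arc at a hole-column rhombus `r` strictly above the hole, some arc above the row of `r`: with `a = 1` iff the walk's
first turning plaquette `p₁` (on the root row) is visited twice and `b = 1` iff a plaquette of the row of `r` is visited twice (the hook corner), `a, b ≤ 1`,
the phase index is `(9 + 3a + 5b) mod 8` and **`limitWeight = (√2)⁷ · ζ^{4((7 + 3a + 5b) mod 8)}`** (`ζ = e^{iπ/16}`): `ζ²⁸, ζ⁸, ζ¹⁶, ζ²⁸` for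
`(a, b) = (0,0), (1,0), (0,1), (1,1)` — census phases `k = 7, 2, 4, 7`. [cite: GlazmanManolescu2019, §1, Fig. 1 and eq. (1); Lemma 2.1, eq. (CR); §2.1, eq. (2.1)]
[cite: Glazman2015WeightedSAW, Lemma 3.1 (proof, pp. 6–7)] [cite: Hopf1935, Nr. 2 (Umlaufsatz, p. 53)] -/
theorem limitWeight_of_cost_seven_straight_holeColumn_above (hh : holeFaceW w ∉ D) (hr : RootedFace D (w.side .W) r) (h : ω.IsB2a)
    (hA : ω.AJ hr h (toC (midPt (w.side .W))) ≠ 0) (hc : cost (slotOfSide ω.1) ω.2.mids = 7) (hz : ω.1 = .N ∨ ω.1 = .S)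
    (hstr8 : arcKind (ω.2.sIn ω.2.firstHitG) (ω.2.sOut ω.2.firstHitG) = .straight) (hcol : r.1 = w.1 - 1) (habove : w.2 < r.2)
    (hup : ∃ j < ω.2.arcs.length, r.2 < (ω.2.fc j).2) :
    ∃ a b : ℕ, a ≤ 1 ∧ b ≤ 1 ∧
      ((a = 1 ↔ ∃ l l' : ℕ, l < ω.2.arcs.length ∧ l' < ω.2.arcs.length ∧ l ≠ l' ∧ ω.2.fc l = ω.2.fc l' ∧ (ω.2.fc l).2 = w.2) ∧
        (b = 1 ↔ ∃ l l' : ℕ, l < ω.2.arcs.length ∧ l' < ω.2.arcs.length ∧ l ≠ l' ∧ ω.2.fc l = ω.2.fc l' ∧ (ω.2.fc l).2 = r.2)) ∧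
      phaseIndex ω.2.mids = (9 + 3 * a + 5 * b) % 8 ∧
      limitWeight (slotOfSide ω.1) ω.2.mids = ((Real.sqrt 2 : ℝ) : ℂ) ^ 7 * zeta32 ^ (4 * ((7 + 3 * a + 5 * b) % 8)) := by
  obtain ⟨a, b, ha, hb, hkiss, hX⟩ := phaseIndex_of_cost_seven_straight_holeColumn_above hh hr h hA hc hz hstr8 hcol habove hup
  obtain ⟨hN, hm⟩ := isolated_eq_seven_of_cost_seven_straight_holeColumn_above hh hr h hA hc hz hstr8 hcol habove hup
  refine ⟨a, b, ha, hb, hkiss, hX, ?_⟩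
  have hvert : vertB (w.side .W) = true := by rw [vertB_side_eq_slotDeg]; rfl
  have hlw := limitWeight_eq_phaseIndex ω.2 hvert (slotOfSide ω.1) (vertB_side_eq_slotDeg r ω.1)
  rw [hm, hX] at hlw
  rw [hlw, hN]
  have hsign : slotSign (slotOfSide .N) = 1 := by rfl
  rw [hsign, one_mul, zeta32_four_add_twelve_eq_sqrt, mul_pow, ← pow_mul, mul_assoc, ← pow_add]
  congr 1
  rw [zeta32_pow_mod]
  interval_cases a <;> interval_cases b <;> norm_num

/-- ★★★ **HOLE COLUMN: THREE PHASES, NO ANTIPODAL PAIR.** Under the same hypotheses `limitWeight ∈ {(√2)⁷ζ²⁸, (√2)⁷ζ⁸, (√2)⁷ζ¹⁶}` — census phases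
`k ∈ {7, 2, 4}`, a subset of the antipode-free set `{1, 2, 4, 7}` of `sum_phases_above_eq_zero_iff`: these members can never cancel among themselves in the
level-`7` wound sum. [cite: GlazmanManolescu2019, §1, Fig. 1 and eq. (1); Lemma 2.1, eq. (CR); §2.1, eq. (2.1)] [cite: Glazman2015WeightedSAW, Lemma 3.1 (proof, pp. 6–7)] -/
theorem limitWeight_mem_of_cost_seven_straight_holeColumn_above (hh : holeFaceW w ∉ D) (hr : RootedFace D (w.side .W) r) (h : ω.IsB2a)
    (hA : ω.AJ hr h (toC (midPt (w.side .W))) ≠ 0) (hc : cost (slotOfSide ω.1) ω.2.mids = 7) (hz : ω.1 = .N ∨ ω.1 = .S)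
    (hstr8 : arcKind (ω.2.sIn ω.2.firstHitG) (ω.2.sOut ω.2.firstHitG) = .straight) (hcol : r.1 = w.1 - 1) (habove : w.2 < r.2)
    (hup : ∃ j < ω.2.arcs.length, r.2 < (ω.2.fc j).2) :
    limitWeight (slotOfSide ω.1) ω.2.mids = ((Real.sqrt 2 : ℝ) : ℂ) ^ 7 * zeta32 ^ 28 ∨
      limitWeight (slotOfSide ω.1) ω.2.mids = ((Real.sqrt 2 : ℝ) : ℂ) ^ 7 * zeta32 ^ 8 ∨
      limitWeight (slotOfSide ω.1) ω.2.mids = ((Real.sqrt 2 : ℝ) : ℂ) ^ 7 * zeta32 ^ 16 := by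
  obtain ⟨a, b, ha, hb, -, -, hlw⟩ := limitWeight_of_cost_seven_straight_holeColumn_above hh hr h hA hc hz hstr8 hcol habove hup
  rw [hlw]
  interval_cases a <;> interval_cases b <;> norm_num

/-- ★★★ **HOLE COLUMN: THE PHASE INDEX IS `1`, `4` OR `6`.** Under the same hypotheses `phaseIndex ∈ {1, 4, 6}` (tree units; census units `k = X + 6 ∈ {7, 2, 4}`):
no two of these are antipodal (`X ↔ X + 4`). [cite: GlazmanManolescu2019, §1, Fig. 1 and eq. (1); Lemma 2.1, eq. (CR); §2.1, eq. (2.1)]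
[cite: Glazman2015WeightedSAW, Lemma 3.1 (proof, pp. 6–7)] -/
theorem phaseIndex_mem_of_cost_seven_straight_holeColumn_above (hh : holeFaceW w ∉ D) (hr : RootedFace D (w.side .W) r) (h : ω.IsB2a)
    (hA : ω.AJ hr h (toC (midPt (w.side .W))) ≠ 0) (hc : cost (slotOfSide ω.1) ω.2.mids = 7) (hz : ω.1 = .N ∨ ω.1 = .S)
    (hstr8 : arcKind (ω.2.sIn ω.2.firstHitG) (ω.2.sOut ω.2.firstHitG) = .straight) (hcol : r.1 = w.1 - 1) (habove : w.2 < r.2)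
    (hup : ∃ j < ω.2.arcs.length, r.2 < (ω.2.fc j).2) :
    phaseIndex ω.2.mids = 1 ∨ phaseIndex ω.2.mids = 4 ∨ phaseIndex ω.2.mids = 6 := by
  obtain ⟨a, b, ha, hb, -, hX⟩ := phaseIndex_of_cost_seven_straight_holeColumn_above hh hr h hA hc hz hstr8 hcol habove hup
  rw [hX]
  interval_cases a <;> interval_cases b <;> norm_num

end ΩG

end Literature.Probability.RandomPlanarGeometry.SAW.YangBaxter
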